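import Summits.NavierStokesRegularity.NavierStokesRegularity.Theses.RecurrentProfiles
import Summits.NavierStokesRegularity.NavierStokesRegularity.Theses.SqueezeCycle
import Summits.NavierStokesRegularity.NavierStokesRegularity.Theorems.RecurrentProfilesRecurrentLiouvilleFrFastRecurrenceRemoval
import Literature.Analysis.FluidPDE.ScalingUniformRecurrence
import HarnessLib

/-!
# Crux `RecurrentLiouville` (stmt-NavierStokesRegularity-1589), line `Sketch` v7 (fast recurrence
# removal) — the typed certificate: the bet `SlowRecurrentLiouville` is the crux

Theorems-only file (no definitions, no named facts).  Skeleton v7 composes the crux from the fast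
recurrence removal theorem S4 (`stub_frFastRecurrenceRemoval`: `∃ L(C,M), δ(C,M) > 0`, a class member
whose scaling orbit returns `δ`-close in `L³(Q(0,1))` within every log-scale window of length `L` is
regular) and the bet B (`stub_frSlowRecurrentLiouville`: uniformly recurrent class members whose
`δ`-returns miss some window of length `L` are regular).  This file is the kernel-checked certificate
that B carries the whole crux (Disproof §A3 / §E1 shape — the recurrence clause is not load-bearing):

* `recurrentLiouville_of_fast_of_slow` — S4 ⇒ B ⇒ crux (the skeleton's composition: dichotomy on
  the return gaps at precision `δ(C,𝐈)`);
* `slowRecurrent_of_recurrentLiouville` — crux ⇒ B (vacuity: the crux already makes every uniformly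
  recurrent class member regular);
* `slowRecurrent_iff_recurrentLiouville_of_fast` — given S4, B ⟺ crux (both route copies);
* `slowRecurrent_iff_recurrentLiouville`, `stub_frBetIffCrux` — the unconditional certificate (S4 landed).

So line Sketch v7 is COMPLETE modulo the crux itself; its content is the harvest
(fast recurrence removal, its epoch form, the Chae rung, the class-uniform orbit modulus).

## References

* H. Furstenberg, *Recurrence in Ergodic Theory and Combinatorial Number Theory* (1981), Ch. 1 §4.
  [Furstenberg1981]
* D. Albritton, T. Barker, J. Math. Fluid Mech. 21 (2019), Prop. 2.3, §3. [AlbrittonBarker2019]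
-/

noncomputable section

-- the sub-problem namespace repeats the summit name (D-0017 layout `Summit.<S>.<P>.Theorems`)
set_option linter.dupNamespace false

namespace Summit.NavierStokesRegularity.NavierStokesRegularity.Theorems

open MeasureTheory Set Function Filter Topology TopologicalSpace Metric
open Literature.Analysis Literature.Analysis.FluidPDE
open scoped NNReal ENNReal

/-- **S4 and the bet give the crux** (the composition of skeleton v7): fast recurrence removal
supplies `L(C,𝐈)`, `δ(C,𝐈)`; either the recurrent class member returns `δ`-close within every
window of length `L` — then S4 removes the origin singularity — or its `δ`-returns miss some window
and the bet applies. [cite: AlbrittonBarker2019, Prop. 2.3] -/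
theorem recurrentLiouville_of_fast_of_slow
    (hS4 : ∀ (C : ℝ) (M : ℝ≥0∞), M < ⊤ → ∃ L : ℝ, 0 < L ∧ ∃ δ : ℝ, 0 < δ ∧
      ∀ (u : ℝ → EuclideanSpace ℝ (Fin 3) → EuclideanSpace ℝ (Fin 3))
        (p : ℝ → EuclideanSpace ℝ (Fin 3) → ℝ)
        (G : ℝ → EuclideanSpace ℝ (Fin 3) → EuclideanSpace ℝ (Fin 3) →L[ℝ] EuclideanSpace ℝ (Fin 3)),
        IsSuitableWeakSolutionOn (slab (EuclideanSpace ℝ (Fin 3)) (Iio 0) isOpen_Iio) 1 0 u p →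
        HasWeakSpatialGradientOn (slab (EuclideanSpace ℝ (Fin 3)) (Iio 0) isOpen_Iio) u G →
        typeIBound (Iio (0 : ℝ) ×ˢ univ) u p G ≤ M →
        HasTypeITimeDecay C u →
        (∀ a : ℝ, ∃ σ ∈ Icc a (a + L),
          eLpNorm (uncurry (nsRescale (Real.exp σ) u) - uncurry u) 3
            (volume.restrict (parabolicCylinder 1 (0 : ℝ × EuclideanSpace ℝ (Fin 3)))) ≤ ENNReal.ofReal δ) →
        ¬ IsBackwardSingularPoint u 0)
    (hB : ∀ (C : ℝ) (M : ℝ≥0∞), M < ⊤ → ∀ (L δ : ℝ), 0 < L → 0 < δ →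
      ∀ (u : ℝ → EuclideanSpace ℝ (Fin 3) → EuclideanSpace ℝ (Fin 3))
        (p : ℝ → EuclideanSpace ℝ (Fin 3) → ℝ)
        (G : ℝ → EuclideanSpace ℝ (Fin 3) → EuclideanSpace ℝ (Fin 3) →L[ℝ] EuclideanSpace ℝ (Fin 3)),
        IsSuitableWeakSolutionOn (slab (EuclideanSpace ℝ (Fin 3)) (Iio 0) isOpen_Iio) 1 0 u p →
        HasWeakSpatialGradientOn (slab (EuclideanSpace ℝ (Fin 3)) (Iio 0) isOpen_Iio) u G →
        typeIBound (Iio (0 : ℝ) ×ˢ univ) u p G ≤ M →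
        HasTypeITimeDecay C u →
        (∀ ε : ℝ, 0 < ε → ∀ K : Set (ℝ × EuclideanSpace ℝ (Fin 3)), IsCompact K →
          K ⊆ Set.Iic (0 : ℝ) ×ˢ Set.univ → ∃ L : ℝ, 0 < L ∧ ∀ a : ℝ, ∃ σ ∈ Set.Icc a (a + L),
            eLpNorm (fun z : ℝ × EuclideanSpace ℝ (Fin 3) => nsRescale (Real.exp σ) u z.1 z.2 - u z.1 z.2) 3
              (volume.restrict K) ≤ ENNReal.ofReal ε) →
        (∃ a : ℝ, ∀ σ ∈ Icc a (a + L),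
          ENNReal.ofReal δ <
            eLpNorm (uncurry (nsRescale (Real.exp σ) u) - uncurry u) 3
              (volume.restrict (parabolicCylinder 1 (0 : ℝ × EuclideanSpace ℝ (Fin 3))))) →
        ¬ IsBackwardSingularPoint u 0) :
    Theses.RecurrentProfiles.RecurrentLiouville := by
  intro u p G C hsw hwg hI hdec hrec
  obtain ⟨L, hL, δ, hδ, hfast⟩ := hS4 C (typeIBound (Iio (0 : ℝ) ×ˢ univ) u p G) hI
  by_cases h : ∀ a : ℝ, ∃ σ ∈ Icc a (a + L),
      eLpNorm (uncurry (nsRescale (Real.exp σ) u) - uncurry u) 3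
        (volume.restrict (parabolicCylinder 1 (0 : ℝ × EuclideanSpace ℝ (Fin 3)))) ≤ ENNReal.ofReal δ
  · exact hfast u p G hsw hwg le_rfl hdec h
  · push Not at h
    exact hB C _ hI L δ hL hδ u p G hsw hwg le_rfl hdec hrec h

/-- **The crux gives the bet** (vacuity): under `RecurrentLiouville` every uniformly recurrent class
member is regular at the origin, whatever its return gaps. [cite: Furstenberg1981, Ch. 1 §4] -/
theorem slowRecurrent_of_recurrentLiouville (hRL : Theses.RecurrentProfiles.RecurrentLiouville) :
    ∀ (C : ℝ) (M : ℝ≥0∞), M < ⊤ → ∀ (L δ : ℝ), 0 < L → 0 < δ →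
      ∀ (u : ℝ → EuclideanSpace ℝ (Fin 3) → EuclideanSpace ℝ (Fin 3))
        (p : ℝ → EuclideanSpace ℝ (Fin 3) → ℝ)
        (G : ℝ → EuclideanSpace ℝ (Fin 3) → EuclideanSpace ℝ (Fin 3) →L[ℝ] EuclideanSpace ℝ (Fin 3)),
        IsSuitableWeakSolutionOn (slab (EuclideanSpace ℝ (Fin 3)) (Iio 0) isOpen_Iio) 1 0 u p →
        HasWeakSpatialGradientOn (slab (EuclideanSpace ℝ (Fin 3)) (Iio 0) isOpen_Iio) u G →
        typeIBound (Iio (0 : ℝ) ×ˢ univ) u p G ≤ M →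
        HasTypeITimeDecay C u →
        (∀ ε : ℝ, 0 < ε → ∀ K : Set (ℝ × EuclideanSpace ℝ (Fin 3)), IsCompact K →
          K ⊆ Set.Iic (0 : ℝ) ×ˢ Set.univ → ∃ L : ℝ, 0 < L ∧ ∀ a : ℝ, ∃ σ ∈ Set.Icc a (a + L),
            eLpNorm (fun z : ℝ × EuclideanSpace ℝ (Fin 3) => nsRescale (Real.exp σ) u z.1 z.2 - u z.1 z.2) 3
              (volume.restrict K) ≤ ENNReal.ofReal ε) →
        (∃ a : ℝ, ∀ σ ∈ Icc a (a + L),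
          ENNReal.ofReal δ <
            eLpNorm (uncurry (nsRescale (Real.exp σ) u) - uncurry u) 3
              (volume.restrict (parabolicCylinder 1 (0 : ℝ × EuclideanSpace ℝ (Fin 3))))) →
        ¬ IsBackwardSingularPoint u 0 :=
  fun C _ hM _ _ _ _ u p G hsw hwg hI hdec hrec _ =>
    hRL u p G C hsw hwg (lt_of_le_of_lt hI hM) hdec hrec

/-- **The bet is the crux, given S4** (typed certificate): with fast recurrence removal in hand, the
line's single research-open stub `stub_frSlowRecurrentLiouville` is EQUIVALENT to
`RecurrentLiouville`. [cite: AlbrittonBarker2019, Prop. 2.3] -/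
theorem slowRecurrent_iff_recurrentLiouville_of_fast
    (hS4 : ∀ (C : ℝ) (M : ℝ≥0∞), M < ⊤ → ∃ L : ℝ, 0 < L ∧ ∃ δ : ℝ, 0 < δ ∧
      ∀ (u : ℝ → EuclideanSpace ℝ (Fin 3) → EuclideanSpace ℝ (Fin 3))
        (p : ℝ → EuclideanSpace ℝ (Fin 3) → ℝ)
        (G : ℝ → EuclideanSpace ℝ (Fin 3) → EuclideanSpace ℝ (Fin 3) →L[ℝ] EuclideanSpace ℝ (Fin 3)),
        IsSuitableWeakSolutionOn (slab (EuclideanSpace ℝ (Fin 3)) (Iio 0) isOpen_Iio) 1 0 u p →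
        HasWeakSpatialGradientOn (slab (EuclideanSpace ℝ (Fin 3)) (Iio 0) isOpen_Iio) u G →
        typeIBound (Iio (0 : ℝ) ×ˢ univ) u p G ≤ M →
        HasTypeITimeDecay C u →
        (∀ a : ℝ, ∃ σ ∈ Icc a (a + L),
          eLpNorm (uncurry (nsRescale (Real.exp σ) u) - uncurry u) 3
            (volume.restrict (parabolicCylinder 1 (0 : ℝ × EuclideanSpace ℝ (Fin 3)))) ≤ ENNReal.ofReal δ) →
        ¬ IsBackwardSingularPoint u 0) :
    (∀ (C : ℝ) (M : ℝ≥0∞), M < ⊤ → ∀ (L δ : ℝ), 0 < L → 0 < δ →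
      ∀ (u : ℝ → EuclideanSpace ℝ (Fin 3) → EuclideanSpace ℝ (Fin 3))
        (p : ℝ → EuclideanSpace ℝ (Fin 3) → ℝ)
        (G : ℝ → EuclideanSpace ℝ (Fin 3) → EuclideanSpace ℝ (Fin 3) →L[ℝ] EuclideanSpace ℝ (Fin 3)),
        IsSuitableWeakSolutionOn (slab (EuclideanSpace ℝ (Fin 3)) (Iio 0) isOpen_Iio) 1 0 u p →
        HasWeakSpatialGradientOn (slab (EuclideanSpace ℝ (Fin 3)) (Iio 0) isOpen_Iio) u G →
        typeIBound (Iio (0 : ℝ) ×ˢ univ) u p G ≤ M →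
        HasTypeITimeDecay C u →
        (∀ ε : ℝ, 0 < ε → ∀ K : Set (ℝ × EuclideanSpace ℝ (Fin 3)), IsCompact K →
          K ⊆ Set.Iic (0 : ℝ) ×ˢ Set.univ → ∃ L : ℝ, 0 < L ∧ ∀ a : ℝ, ∃ σ ∈ Set.Icc a (a + L),
            eLpNorm (fun z : ℝ × EuclideanSpace ℝ (Fin 3) => nsRescale (Real.exp σ) u z.1 z.2 - u z.1 z.2) 3
              (volume.restrict K) ≤ ENNReal.ofReal ε) →
        (∃ a : ℝ, ∀ σ ∈ Icc a (a + L),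
          ENNReal.ofReal δ <
            eLpNorm (uncurry (nsRescale (Real.exp σ) u) - uncurry u) 3
              (volume.restrict (parabolicCylinder 1 (0 : ℝ × EuclideanSpace ℝ (Fin 3))))) →
        ¬ IsBackwardSingularPoint u 0) ↔
    Theses.RecurrentProfiles.RecurrentLiouville :=
  ⟨recurrentLiouville_of_fast_of_slow hS4, slowRecurrent_of_recurrentLiouville⟩

/-- The same certificate against the SqueezeCycle copy of the crux (the two route copies agree
letter for letter, `Iff.rfl`). [cite: AlbrittonBarker2019, Prop. 2.3] -/
theorem slowRecurrent_iff_recurrentLiouville_of_fast'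
    (hS4 : ∀ (C : ℝ) (M : ℝ≥0∞), M < ⊤ → ∃ L : ℝ, 0 < L ∧ ∃ δ : ℝ, 0 < δ ∧
      ∀ (u : ℝ → EuclideanSpace ℝ (Fin 3) → EuclideanSpace ℝ (Fin 3))
        (p : ℝ → EuclideanSpace ℝ (Fin 3) → ℝ)
        (G : ℝ → EuclideanSpace ℝ (Fin 3) → EuclideanSpace ℝ (Fin 3) →L[ℝ] EuclideanSpace ℝ (Fin 3)),
        IsSuitableWeakSolutionOn (slab (EuclideanSpace ℝ (Fin 3)) (Iio 0) isOpen_Iio) 1 0 u p →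
        HasWeakSpatialGradientOn (slab (EuclideanSpace ℝ (Fin 3)) (Iio 0) isOpen_Iio) u G →
        typeIBound (Iio (0 : ℝ) ×ˢ univ) u p G ≤ M →
        HasTypeITimeDecay C u →
        (∀ a : ℝ, ∃ σ ∈ Icc a (a + L),
          eLpNorm (uncurry (nsRescale (Real.exp σ) u) - uncurry u) 3
            (volume.restrict (parabolicCylinder 1 (0 : ℝ × EuclideanSpace ℝ (Fin 3)))) ≤ ENNReal.ofReal δ) →
        ¬ IsBackwardSingularPoint u 0) :
    (∀ (C : ℝ) (M : ℝ≥0∞), M < ⊤ → ∀ (L δ : ℝ), 0 < L → 0 < δ →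
      ∀ (u : ℝ → EuclideanSpace ℝ (Fin 3) → EuclideanSpace ℝ (Fin 3))
        (p : ℝ → EuclideanSpace ℝ (Fin 3) → ℝ)
        (G : ℝ → EuclideanSpace ℝ (Fin 3) → EuclideanSpace ℝ (Fin 3) →L[ℝ] EuclideanSpace ℝ (Fin 3)),
        IsSuitableWeakSolutionOn (slab (EuclideanSpace ℝ (Fin 3)) (Iio 0) isOpen_Iio) 1 0 u p →
        HasWeakSpatialGradientOn (slab (EuclideanSpace ℝ (Fin 3)) (Iio 0) isOpen_Iio) u G →
        typeIBound (Iio (0 : ℝ) ×ˢ univ) u p G ≤ M →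
        HasTypeITimeDecay C u →
        (∀ ε : ℝ, 0 < ε → ∀ K : Set (ℝ × EuclideanSpace ℝ (Fin 3)), IsCompact K →
          K ⊆ Set.Iic (0 : ℝ) ×ˢ Set.univ → ∃ L : ℝ, 0 < L ∧ ∀ a : ℝ, ∃ σ ∈ Set.Icc a (a + L),
            eLpNorm (fun z : ℝ × EuclideanSpace ℝ (Fin 3) => nsRescale (Real.exp σ) u z.1 z.2 - u z.1 z.2) 3
              (volume.restrict K) ≤ ENNReal.ofReal ε) →
        (∃ a : ℝ, ∀ σ ∈ Icc a (a + L),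
          ENNReal.ofReal δ <
            eLpNorm (uncurry (nsRescale (Real.exp σ) u) - uncurry u) 3
              (volume.restrict (parabolicCylinder 1 (0 : ℝ × EuclideanSpace ℝ (Fin 3))))) →
        ¬ IsBackwardSingularPoint u 0) ↔
    Theses.SqueezeCycle.RecurrentLiouville :=
  slowRecurrent_iff_recurrentLiouville_of_fast hS4

/-! ### Unconditional form (S4 landed) and the registered certificate stub -/

/-- **The bet is the crux** (typed certificate, unconditional): with fast recurrence removal landed
(`stub_frFastRecurrenceRemoval`), the line's single research-open stub `stub_frSlowRecurrentLiouville`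
is EQUIVALENT to `RecurrentLiouville` (⇒ the skeleton's dichotomy, ⇐ vacuity).  Hence line Sketch v7
is complete modulo the crux itself; its content is the landed harvest.
[cite: AlbrittonBarker2019, Prop. 2.3] -/
theorem slowRecurrent_iff_recurrentLiouville :
    (∀ (C : ℝ) (M : ℝ≥0∞), M < ⊤ → ∀ (L δ : ℝ), 0 < L → 0 < δ →
      ∀ (u : ℝ → EuclideanSpace ℝ (Fin 3) → EuclideanSpace ℝ (Fin 3))
        (p : ℝ → EuclideanSpace ℝ (Fin 3) → ℝ)
        (G : ℝ → EuclideanSpace ℝ (Fin 3) → EuclideanSpace ℝ (Fin 3) →L[ℝ] EuclideanSpace ℝ (Fin 3)),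
        IsSuitableWeakSolutionOn (slab (EuclideanSpace ℝ (Fin 3)) (Iio 0) isOpen_Iio) 1 0 u p →
        HasWeakSpatialGradientOn (slab (EuclideanSpace ℝ (Fin 3)) (Iio 0) isOpen_Iio) u G →
        typeIBound (Iio (0 : ℝ) ×ˢ univ) u p G ≤ M →
        HasTypeITimeDecay C u →
        (∀ ε : ℝ, 0 < ε → ∀ K : Set (ℝ × EuclideanSpace ℝ (Fin 3)), IsCompact K →
          K ⊆ Set.Iic (0 : ℝ) ×ˢ Set.univ → ∃ L : ℝ, 0 < L ∧ ∀ a : ℝ, ∃ σ ∈ Set.Icc a (a + L),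
            eLpNorm (fun z : ℝ × EuclideanSpace ℝ (Fin 3) => nsRescale (Real.exp σ) u z.1 z.2 - u z.1 z.2) 3
              (volume.restrict K) ≤ ENNReal.ofReal ε) →
        (∃ a : ℝ, ∀ σ ∈ Icc a (a + L),
          ENNReal.ofReal δ <
            eLpNorm (uncurry (nsRescale (Real.exp σ) u) - uncurry u) 3
              (volume.restrict (parabolicCylinder 1 (0 : ℝ × EuclideanSpace ℝ (Fin 3))))) →
        ¬ IsBackwardSingularPoint u 0) ↔
    Theses.RecurrentProfiles.RecurrentLiouville :=
  slowRecurrent_iff_recurrentLiouville_of_fast stub_frFastRecurrenceRemoval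

/-- **Registered certificate stub** `stub_frBetIffCrux` (crux stmt-NavierStokesRegularity-1589, line
Sketch v7): the bet `stub_frSlowRecurrentLiouville` ⟺ the crux (fully qualified SqueezeCycle copy; the
two route copies agree letter for letter). [cite: AlbrittonBarker2019, Prop. 2.3] -/
theorem stub_frBetIffCrux :
    (∀ (C : ℝ) (M : ℝ≥0∞), M < ⊤ → ∀ (L δ : ℝ), 0 < L → 0 < δ →
      ∀ (u : ℝ → EuclideanSpace ℝ (Fin 3) → EuclideanSpace ℝ (Fin 3))
        (p : ℝ → EuclideanSpace ℝ (Fin 3) → ℝ)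
        (G : ℝ → EuclideanSpace ℝ (Fin 3) → EuclideanSpace ℝ (Fin 3) →L[ℝ] EuclideanSpace ℝ (Fin 3)),
        IsSuitableWeakSolutionOn (slab (EuclideanSpace ℝ (Fin 3)) (Iio 0) isOpen_Iio) 1 0 u p →
        HasWeakSpatialGradientOn (slab (EuclideanSpace ℝ (Fin 3)) (Iio 0) isOpen_Iio) u G →
        typeIBound (Iio (0 : ℝ) ×ˢ univ) u p G ≤ M →
        HasTypeITimeDecay C u →
        (∀ ε : ℝ, 0 < ε → ∀ K : Set (ℝ × EuclideanSpace ℝ (Fin 3)), IsCompact K →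
          K ⊆ Set.Iic (0 : ℝ) ×ˢ Set.univ → ∃ L : ℝ, 0 < L ∧ ∀ a : ℝ, ∃ σ ∈ Set.Icc a (a + L),
            eLpNorm (fun z : ℝ × EuclideanSpace ℝ (Fin 3) => nsRescale (Real.exp σ) u z.1 z.2 - u z.1 z.2) 3
              (volume.restrict K) ≤ ENNReal.ofReal ε) →
        (∃ a : ℝ, ∀ σ ∈ Icc a (a + L),
          ENNReal.ofReal δ <
            eLpNorm (uncurry (nsRescale (Real.exp σ) u) - uncurry u) 3
              (volume.restrict (parabolicCylinder 1 (0 : ℝ × EuclideanSpace ℝ (Fin 3))))) →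
        ¬ IsBackwardSingularPoint u 0) ↔
    Summit.NavierStokesRegularity.NavierStokesRegularity.Theses.SqueezeCycle.RecurrentLiouville :=
  slowRecurrent_iff_recurrentLiouville

end Summit.NavierStokesRegularity.NavierStokesRegularity.Theorems

end
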